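import Literature.NumberTheory.EllipticCurves.Rank1Residual.X10bMuInvariant
import Literature.NumberTheory.EllipticCurves.Rank1Residual.Typed.SelmerCardCertificate
import HarnessLib

/-!
# X10b, rank `0`, the Tamagawa-blocked RESISTANT pairs: route U2′ at `p = 3` with the partner's
# `BSD(A,3)` from the `3`-descent certificate and C1 as the Kraus–Oesterlé list
# (cell `b2b-bsdres`, unit `b2b-bsdres-x10b`, gen 3)

HONEST FRAMING (run/shared/lean/b2b/bsd-rank1-residual/, verbatim in every file): the goal of the
cell is to DELETE the COMBINATION-SHAPED residual classes of the Birch–Swinnerton-Dyer formula for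
ALL analytic-rank `≤ 1` elliptic curves over `ℚ` — "full BSD formula for every rank `≤ 1` curve in
class `C`" assembled STRICTLY from published theorems — so that the rank-`≤ 1` remainder becomes
exactly the CONSTRUCTION-SHAPED classes, which are TYPED (missing-input `Prop`s), NOT attempted.
This is not "finishing BSD". Theorems only; NO named fact is introduced; X10b's label
(CONSTRUCTION-SHAPED, referee R6.1/R82.3) is not changed; no pair is booked by this file (the lane
books, the referee rules).

## What this file adds (our own composition, hence `Summits/`)

After gen 1 (two-engine `3`-descent: every X10b pair with `3 ∤ #Ш_an` closed per curve) and gen 2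
(Heegner-index certificates + Cha 2005: 18 of the 22 RESISTANT classes `N < 5·10⁵`, rank `0`,
`ord_3 #Ш_an = 2`), the per-curve core of X10b at `N < 5·10⁵` is the four classes with a Tamagawa
number divisible by `3` (`53966a1`, `129605x1`, `427130j1`: one `c_q = 3`; `340186p1`:
`c_2 = c_11 = 3`), for which no Heegner-INDEX bound in print is sharp without a flag, and for
`340186p1` none at all (x10 gen 7, X10-AUDIT §13). Route U2′ (x9 gen 5, `Rank1Residual/X10bMuInvariant.lean`:
`X10b.bsdp_of_bsdpPartner`) does not see Tamagawa numbers: Greenberg–Vatsal 2000 Thm. (1.4)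
transports Mazur's main conjecture with `μ = 0` from a CONGRUENT rank-`0` partner `A` (`A[3] ≅ E[3]`)
to `E`, integrally, whatever the image of `ρ̄_{E,3}`; the partner side needs `BSD(A,3)`, one unit
coefficient of `𝓛_3(A)` (`μ(𝓛_3(A)) = 0`, a finite modular-symbol / twisted-`L`-value certificate) and
the RATIONAL main conjecture for `(A,3)` (Yan–Zhu 2026 Thm. 4.9, named fact
`YanZhu2026.thm49_charIdeal_eq_padicLFunction`, FLAG `YZ26@3-BF-ERL-Ohta`). The census of this unit
(gen 3, `HOME/b2b-bsdres-x10b/X10B-PARTNER.md`) finds rank-`0` congruent partners in Cremona's table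
for exactly these four resistant classes (and for no other of the 22 except the mutual pair
`55696l1 ↔ 55696n1`), every one of them itself an X10b-type `3Ns` curve whose `BSD(A,3)` is gen 1's
EXACT two-engine certificate `#Sel^(3)(A/ℚ) = 1` with `3 ∤ #Ш_an(A)` — NOT a curve of conductor
`< 5000` in general (`336973q1`, `154630n1`, `22090n1`; `1210d1` is both). So the kernel shape the
records need is `X10b.bsdp_of_bsdpPartner` with

* `BSDp A 3` DISCHARGED from the descent line by the class-free tree theorem
  `Typed.bsdp_of_card_selmerGroup_eq_pow_analyticRank` (GZK + `#Sel^(3)(A/ℚ) = 3^{r_an(A)} = 1` +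
  `3 ∤ #Ш_an(A)`), and
* C1 (`A[3] ≅ E[3]`, `Γ_ℚ`-equivariantly) DISCHARGED from the finite Kraus–Oesterlé congruence list
  (`KrausOesterle1992.torsionIso_of_congruences`, named fact `prop4_torsionIso_of_congruences`),

which is `bsdp_three_of_partner_of_congruences_of_card_selmerThree` below; the remaining per-pair
binders are finite certificates (`hcong`: two engines, x9-g5's numpy and PARI Kraus–Oesterlé engines;
`hcardA`, `hqA`/`hvA`: gen 1's four descent runs and Cremona/PARI; `hcertA`: the unit coefficient,
three engines A/B/L of gen 3; `hr`, `hrA`: `L(·,1) ≠ 0`). `bsdp_three_of_partner_of_congruences`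
keeps `BSDp A 3` as a binder (partner closed by any other route), and
`missingInputAt_of_partner_of_congruences_of_card_selmerThree` is the typed bookkeeping
(`Typed.X10b.MissingInputAt`). PUBLISHED binders throughout: Yan–Zhu Thm. 4.9 (`hYZ`, PUB*, flag),
Kraus–Oesterlé Prop. 4 (`hKO`), Greenberg LNM 1716 Thm. 4.1 (`hGr`), the period units (`h5`, `h3`),
Greenberg–Vatsal Thm. (1.4) (`hGV`), modularity (`hmodP`, `hmodL`), Gross–Zagier–Kolyvagin (`hGZK`).

What this does NOT do: it does not touch the rank-`1` half of X10b, proves nothing about a class,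
and closes no pair until the certificates are lane-certified and the referee has ruled on the
booking tier under the flag `YZ26@3-BF-ERL-Ohta` (R47.2 (a): U2′ bookable with the unit coefficient
two-engine).

References: Greenberg–Vatsal, Invent. Math. 142 (2000) Thm. (1.4) [GreenbergVatsal2000];
Kraus–Oesterlé, Math. Ann. 293 (1992) Prop. 4 [KrausOesterle1992]; Yan–Zhu, J. Algebra (2026)
Thm. 4.9 [YanZhu2024MainConjNonCM]; Greenberg, LNM 1716 (1999) Thm. 4.1 [GreenbergLNM1716];
Miller, LMS JCM 14 (2011) Def. 1.1 [Miller2011LMS]; HOME/b2b-bsdres-x10b/X10B-PARTNER.md.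
-/

set_option autoImplicit false

noncomputable section

open scoped Classical MatrixGroups ModularForm

open CongruenceSubgroup WeierstrassCurve Literature.NumberTheory.EllipticCurves
  Literature.NumberTheory.EllipticCurves.ModularForms Literature.NumberTheory.EllipticCurves.Rank1Residual

namespace Summit.BirchSwinnertonDyer.Rank1Residual.X10

variable (W A : WeierstrassCurve ℚ) [W.IsElliptic] [W.IsGloballyMinimal] [A.IsElliptic]
  [A.IsGloballyMinimal] (p : ℕ) [Fact p.Prime]

/-- **Class X10b, analytic rank `0`, route U2′ at `p = 3` with C1 as the Kraus–Oesterlé list and the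
partner's `BSD(A,p)` as a binder.** For `W` with `ClassX10 W p` (so `p = 3`), `ρ̄_{E,3}` not
surjective (`hns`, recorded not used), `r_an(W) = 0`; a globally minimal partner `A`, good ordinary at
`p`, `r_an(A) = 0`, `BSDp A p` (`hbsdA`), one unit coefficient of `ϖ·𝓛_p(f_A, α)` (`hcertA`); and the
finite congruence list `hcong` (Kraus–Oesterlé 1992 Prop. 4: `a_ℓ(W) ≡ a_ℓ(A)`, resp.
`a_ℓ(W)a_ℓ(A) ≡ ℓ + 1`, modulo `p` for every prime `ℓ` with `6ℓ < [SL₂(ℤ) : Γ₀(M)]`): `BSDp W p`.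
Composition of `KrausOesterle1992.torsionIso_of_congruences` with `X10b.bsdp_of_bsdpPartner`
(Greenberg–Vatsal transfer; the rational main conjecture for `A` from Yan–Zhu Thm. 4.9, `hYZ`).
[cite: GreenbergVatsal2000, Thm. (1.4) (arXiv p. 5)] [cite: KrausOesterle1992, Prop. 4]
[cite: YanZhu2024MainConjNonCM, Thm. 4.9 (§4.4)] -/
theorem bsdp_three_of_partner_of_congruences
    (hYZ : YanZhu2026.thm49_charIdeal_eq_padicLFunction)
    (hKO : KrausOesterle1992.prop4_torsionIso_of_congruences)
    (hGr : greenberg_charValue_rankZero) (h5 : realPeriodRat_eq_unit_mul_plusPeriod)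
    (h3 : realPeriodRat_eq_unit_mul_plusPeriod_three)
    (hGV : GreenbergVatsal2000.thm14_mainConjecture_transfer_of_torsionIso)
    (hmodP : nonempty_modularParametrizationData) (hmodL : hasEntireLFunction_rat)
    (hGZK : rank_eq_analyticRank_of_analyticRank_le_one)
    (hX10 : ClassX10 W p) (hns : ¬ Surj W 3) (hr : W.analyticRank = 0)
    (hgoodA : A.HasGoodReductionAtPrime p) (hordA : ¬ (p : ℤ) ∣ A.frobeniusTrace p)
    (hrA : A.analyticRank = 0) (hbsdA : BSDp A p)
    (hcertA : ∀ [NeZero (A.conductorNorm ℤ)] (fA : CuspForm (Gamma0 (A.conductorNorm ℤ)) 2),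
        IsNewformOf A fA → ∀ (ϖ : ℚ), (ϖ : ℝ) * A.realPeriodRat = plusPeriod fA →
      ∃ n : ℕ, ‖PowerSeries.coeff n
        (PowerSeries.C (ϖ : ℚ_[p]) * padicLFunction fA (unitRoot A p : ℚ_[p]))‖ = 1)
    (hcong : ∀ (ℓ : ℕ) [Fact ℓ.Prime],
      6 * ℓ < KrausOesterle1992.gammaZeroIndex (KrausOesterle1992.modulus W A) →
      (padicValNat ℓ (W.conductorNorm ℤ * A.conductorNorm ℤ) = 0 →
          (p : ℤ) ∣ W.frobeniusTrace ℓ - A.frobeniusTrace ℓ) ∧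
        (padicValNat ℓ (W.conductorNorm ℤ * A.conductorNorm ℤ) = 1 →
          (p : ℤ) ∣ W.frobeniusTrace ℓ * A.frobeniusTrace ℓ - (ℓ + 1))) :
    BSDp W p := by
  obtain ⟨hp3, -, hirr, -⟩ := id hX10
  have hp2 : p ≠ 2 := by omega
  have hirr' : W.HasIrreducibleModPGaloisRep p := by subst hp3; exact hirr
  obtain ⟨e, he⟩ := KrausOesterle1992.torsionIso_of_congruences hKO W A p hirr' hcong
  have hirrA : A.HasIrreducibleModPGaloisRep p :=
    hasIrreducibleModPGaloisRep_of_torsionIso_symm e he hirr'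
  exact X10b.bsdp_of_bsdpPartner W A p (rationalMC_of_yanZhu A p hYZ hp2 hgoodA hordA hirrA) hGr h5 h3
    hGV hmodP hmodL hGZK hX10 hns hr hgoodA hordA hrA hbsdA hcertA ⟨e, he⟩

/-- **Class X10b, analytic rank `0`, route U2′ at `p = 3` — the Tamagawa-blocked shape: the partner's
`BSD(A,p)` DISCHARGED from the `p`-descent certificate.** As `bsdp_three_of_partner_of_congruences`,
with `BSDp A p` replaced by gen 1's descent line for the partner: the exact `#Ш_an(A) = q ∈ ℚ` with
`ord_p q = 0` (`hqA`, `hvA`) and `#Sel^(p)(A/ℚ) = 1` (`hcardA`; `= p^{r_an(A)}` in rank `0`), through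
the class-free tree theorem `Typed.bsdp_of_card_selmerGroup_eq_pow_analyticRank`
(Gross–Zagier–Kolyvagin + Mordell–Weil + the Selmer sequence). This is the kernel theorem the gen-3
records instantiate for `53966a1 ← 1210d1`, `427130j1 ← 1210d1`, `129605x1 ← 336973q1`,
`340186p1 ← 154630n1`: every binder a PUBLISHED named fact (`hYZ` PUB* with flag
`YZ26@3-BF-ERL-Ohta`) or a FINITE per-pair certificate; Tamagawa numbers of `W` do not enter.
[cite: GreenbergVatsal2000, Thm. (1.4) (arXiv p. 5)] [cite: KrausOesterle1992, Prop. 4]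
[cite: YanZhu2024MainConjNonCM, Thm. 4.9 (§4.4)] [cite: Miller2011LMS, §1 and Def. 1.1] -/
theorem bsdp_three_of_partner_of_congruences_of_card_selmerThree
    (hYZ : YanZhu2026.thm49_charIdeal_eq_padicLFunction)
    (hKO : KrausOesterle1992.prop4_torsionIso_of_congruences)
    (hGr : greenberg_charValue_rankZero) (h5 : realPeriodRat_eq_unit_mul_plusPeriod)
    (h3 : realPeriodRat_eq_unit_mul_plusPeriod_three)
    (hGV : GreenbergVatsal2000.thm14_mainConjecture_transfer_of_torsionIso)
    (hmodP : nonempty_modularParametrizationData) (hmodL : hasEntireLFunction_rat)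
    (hGZK : rank_eq_analyticRank_of_analyticRank_le_one)
    (hX10 : ClassX10 W p) (hns : ¬ Surj W 3) (hr : W.analyticRank = 0)
    (hgoodA : A.HasGoodReductionAtPrime p) (hordA : ¬ (p : ℤ) ∣ A.frobeniusTrace p)
    (hrA : A.analyticRank = 0) {q : ℚ} (hqA : shaAn A = (q : ℂ)) (hvA : padicValRat p q = 0)
    (hcardA : Nat.card (A.selmerGroup (p : ℤ)) = 1)
    (hcertA : ∀ [NeZero (A.conductorNorm ℤ)] (fA : CuspForm (Gamma0 (A.conductorNorm ℤ)) 2),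
        IsNewformOf A fA → ∀ (ϖ : ℚ), (ϖ : ℝ) * A.realPeriodRat = plusPeriod fA →
      ∃ n : ℕ, ‖PowerSeries.coeff n
        (PowerSeries.C (ϖ : ℚ_[p]) * padicLFunction fA (unitRoot A p : ℚ_[p]))‖ = 1)
    (hcong : ∀ (ℓ : ℕ) [Fact ℓ.Prime],
      6 * ℓ < KrausOesterle1992.gammaZeroIndex (KrausOesterle1992.modulus W A) →
      (padicValNat ℓ (W.conductorNorm ℤ * A.conductorNorm ℤ) = 0 →
          (p : ℤ) ∣ W.frobeniusTrace ℓ - A.frobeniusTrace ℓ) ∧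
        (padicValNat ℓ (W.conductorNorm ℤ * A.conductorNorm ℤ) = 1 →
          (p : ℤ) ∣ W.frobeniusTrace ℓ * A.frobeniusTrace ℓ - (ℓ + 1))) :
    BSDp W p := by
  have hbsdA : BSDp A p :=
    Typed.bsdp_of_card_selmerGroup_eq_pow_analyticRank A p hGZK (by omega) hqA hvA
      (by rw [hrA, pow_zero]; exact hcardA)
  exact bsdp_three_of_partner_of_congruences W A p hYZ hKO hGr h5 h3 hGV hmodP hmodL hGZK hX10 hns hr
    hgoodA hordA hrA hbsdA hcertA hcong

/-- **The typed X10b output at such a pair**: `Typed.X10b.MissingInputAt W` (`= MissingPPartAt W 3`,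
the exact `3`-part statement of `Typed/Basic.lean`), from
`bsdp_three_of_partner_of_congruences_of_card_selmerThree`. Bookkeeping; per pair.
[cite: Miller2011LMS, §1 Def. 1.1] -/
theorem missingInputAt_of_partner_of_congruences_of_card_selmerThree
    (hYZ : YanZhu2026.thm49_charIdeal_eq_padicLFunction)
    (hKO : KrausOesterle1992.prop4_torsionIso_of_congruences)
    (hGr : greenberg_charValue_rankZero) (h5 : realPeriodRat_eq_unit_mul_plusPeriod)
    (h3 : realPeriodRat_eq_unit_mul_plusPeriod_three)
    (hGV : GreenbergVatsal2000.thm14_mainConjecture_transfer_of_torsionIso)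
    (hmodP : nonempty_modularParametrizationData) (hmodL : hasEntireLFunction_rat)
    (hGZK : rank_eq_analyticRank_of_analyticRank_le_one)
    (hX10 : ClassX10 W p) (hns : ¬ Surj W 3) (hr : W.analyticRank = 0)
    (hgoodA : A.HasGoodReductionAtPrime p) (hordA : ¬ (p : ℤ) ∣ A.frobeniusTrace p)
    (hrA : A.analyticRank = 0) {q : ℚ} (hqA : shaAn A = (q : ℂ)) (hvA : padicValRat p q = 0)
    (hcardA : Nat.card (A.selmerGroup (p : ℤ)) = 1)
    (hcertA : ∀ [NeZero (A.conductorNorm ℤ)] (fA : CuspForm (Gamma0 (A.conductorNorm ℤ)) 2),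
        IsNewformOf A fA → ∀ (ϖ : ℚ), (ϖ : ℝ) * A.realPeriodRat = plusPeriod fA →
      ∃ n : ℕ, ‖PowerSeries.coeff n
        (PowerSeries.C (ϖ : ℚ_[p]) * padicLFunction fA (unitRoot A p : ℚ_[p]))‖ = 1)
    (hcong : ∀ (ℓ : ℕ) [Fact ℓ.Prime],
      6 * ℓ < KrausOesterle1992.gammaZeroIndex (KrausOesterle1992.modulus W A) →
      (padicValNat ℓ (W.conductorNorm ℤ * A.conductorNorm ℤ) = 0 →
          (p : ℤ) ∣ W.frobeniusTrace ℓ - A.frobeniusTrace ℓ) ∧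
        (padicValNat ℓ (W.conductorNorm ℤ * A.conductorNorm ℤ) = 1 →
          (p : ℤ) ∣ W.frobeniusTrace ℓ * A.frobeniusTrace ℓ - (ℓ + 1))) :
    Typed.X10b.MissingInputAt W := by
  have h := bsdp_three_of_partner_of_congruences_of_card_selmerThree W A p hYZ hKO hGr h5 h3 hGV hmodP
    hmodL hGZK hX10 hns hr hgoodA hordA hrA hqA hvA hcardA hcertA hcong
  obtain ⟨hp3, -⟩ := id hX10
  subst hp3
  haveI : Finite W.sha := (hGZK W (by omega)).2
  exact Typed.missingPPartAt_of_bsdp W 3 h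

end Summit.BirchSwinnertonDyer.Rank1Residual.X10

end
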